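import Summits.ValiantsHypothesis.ValiantsHypothesis.Theorems.LacunarySymmetroidMatrixDescartesFiniteSectorPairSumMasks

/-!
# `MatrixDescartes` — line «stamp»: `ν(12,6) ≤ 2047 = n(12,5)` finite core, kernel slices (part F)

HONEST FRAMING.  Object-search cell `pub-symmetroid`, seat val-sym-door-p5 g13.  HELPER of the crux item `stmt-ValiantsHypothesis-18050` with NO closure claim and no statement about
pencils: SLICES (value #3 of the sorted free values in a range) of the pruned enumeration behind `StampLawAt 12 6 2047` (transfer in
`…FiniteSectorStampCeilingTwelveSix`), in the WALKER shape of `…FiniteSectorIterMasksWalk`: every slice is one Bool term (raw `Nat.rec` walkers over the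
candidates of each level, children of a prefix = an interval by the monotone cover guard, `12`-fold sums as lagged raw-recursor iterates of the shift-or step, the last
level incremental over the cached prefix masks), `decide +kernel`.  The whole enumeration has 12 528 833 live prefixes.  Nothing here bears on the crux, the doors, or `VP ≠ VNP`.
[folklore] Finite enumeration (postage-stamp numbers `n(12,·)`); no citation is load-bearing.
-/

-- `Summit.ValiantsHypothesis.ValiantsHypothesis.…` repeats a component by the D-0017 layout
-- (single-conjunct summit), which the `dupNamespace` linter flags; the name is mandated.
set_option linter.dupNamespace false

namespace Summit.ValiantsHypothesis.ValiantsHypothesis.Theorems.LacunarySymmetroidMatrixDescartes.FiniteSector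

set_option synthInstance.maxSize 2000000 in
set_option synthInstance.maxHeartbeats 2000000 in
set_option maxHeartbeats 4000000 in
set_option maxRecDepth 100000 in
/-- **Finite core of `ν(12,6) ≤ 2047`, slice: value #3 in `[49, 53)`** (504 822 live prefixes; the pruned nested enumeration of the sorted
value lists as ONE Bool walker term — raw `Nat.rec` levels, lagged raw-recursor `12`-fold sum masks, incremental last level; `decide` in the kernel). [folklore] -/
theorem stampWalk_twelve_six_s3_49_53 :
    (@Nat.rec (fun _ => ℕ → Bool) (fun _ => true) (fun (_ : ℕ) (ih : ℕ → Bool) (a : ℕ) => cond (Nat.beq (Nat.mod (Nat.div (@Nat.rec (fun _ => ℕ) ((fun (E : ℕ) => @List.rec ℕ (fun _ => ℕ) 0 (fun (x : ℕ) (_ : List ℕ) (acc : ℕ) => Nat.lor acc (Nat.shiftLeft E x)) [0, 1]) 1) (fun (_ acc : ℕ) => (fun (E : ℕ) => @List.rec ℕ (fun _ => ℕ) 0 (fun (x : ℕ) (_ : List ℕ) (acc : ℕ) => Nat.lor acc (Nat.shiftLeft E x)) [0, 1]) acc) 11) (Nat.pow 2 (a - 1))) 2) 1) (((@Nat.rec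 (fun _ => ℕ → Bool) (fun _ => true) (fun (_ : ℕ) (ih : ℕ → Bool) (b : ℕ) => cond (Nat.beq (Nat.mod (Nat.div (@Nat.rec (fun _ => ℕ) ((fun (E : ℕ) => @List.rec ℕ (fun _ => ℕ) 0 (fun (x : ℕ) (_ : List ℕ) (acc : ℕ) => Nat.lor acc (Nat.shiftLeft E x)) [0, 1, a]) 1) (fun (_ acc : ℕ) => (fun (E : ℕ) => @List.rec ℕ (fun _ => ℕ) 0 (fun (x : ℕ) (_ : List ℕ) (acc : ℕ) => Nat.lor acc (Nat.shiftLeft E x)) [0, 1, a]) acc) 11) (Nat.pow 2 (b - 1))) 2) 1) (((@Nat.rec (fun _ => ℕ → Bool) (fun _ => true) (fun (_ : ℕ) (ih : ℕ → Bool) (c : ℕ) => cond (Nat.beq (Nat.mod (Nat.div (@Nat.rec (fun _ => ℕ) ((fun (E : ℕ) => @List.rec ℕ (fun _ => ℕ) 0 (fun (x : ℕ) (_ : List ℕ) (acc : ℕ) => Nat.lor acc (Nat.shiftLeft E x)) [0, 1, a, b]) 1) (fun (_ acc : ℕ) => (fun (E : ℕ) => @List.rec ℕ (fun _ => ℕ)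 0 (fun (x : ℕ) (_ : List ℕ) (acc : ℕ) => Nat.lor acc (Nat.shiftLeft E x)) [0, 1, a, b]) acc) 11) (Nat.pow 2 (c - 1))) 2) 1) (((@Nat.rec (fun _ => ℕ → Bool) (fun _ => true) (fun (_ : ℕ) (ih : ℕ → Bool) (g : ℕ) => cond (Nat.beq (Nat.mod (Nat.div (@Nat.rec (fun _ => ℕ) ((fun (E : ℕ) => @List.rec ℕ (fun _ => ℕ) 0 (fun (x : ℕ) (_ : List ℕ) (acc : ℕ) => Nat.lor acc (Nat.shiftLeft E x)) [0, 1, a, b, c]) 1) (fun (_ acc : ℕ) => (fun (E : ℕ) => @List.rec ℕ (fun _ => ℕ) 0 (fun (x : ℕ) (_ : List ℕ) (acc : ℕ) => Nat.lor acc (Nat.shiftLeft E x)) [0, 1, a, b, c]) acc) 11) (Nat.pow 2 (g - 1))) 2) 1) ((!(Nat.beq (Nat.mod (@Nat.rec (fun _ => ℕ) 1 (fun (k acc : ℕ) => Nat.lor (@Nat.rec (fun _ => ℕ) ((fun (E : ℕ) => @List.rec ℕ (fun _ => ℕ) 0 (fun (x : ℕ) (_ : List ℕ) (acc : ℕ)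 => Nat.lor acc (Nat.shiftLeft E x)) [0, 1, a, b, c]) 1) (fun (_ acc : ℕ) => (fun (E : ℕ) => @List.rec ℕ (fun _ => ℕ) 0 (fun (x : ℕ) (_ : List ℕ) (acc : ℕ) => Nat.lor acc (Nat.shiftLeft E x)) [0, 1, a, b, c]) acc) k) (Nat.shiftLeft acc g)) 12) (2 ^ 2049)) (2 ^ 2049 - 1))) && ih (g + 1)) true) (2050 - (c + 1)) (c + 1))) && ih (c + 1)) true) ((53 - ((b + 1) + (49 - (b + 1))))) (((b + 1) + (49 - (b + 1)))))) && ih (b + 1)) true) (2050 - (a + 1)) (a + 1))) && ih (a + 1)) true) (2050 - (2)) (2)) = true := by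
  decide +kernel

end Summit.ValiantsHypothesis.ValiantsHypothesis.Theorems.LacunarySymmetroidMatrixDescartes.FiniteSector
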